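import Mathlib
import HarnessLib
import Summits.NavierStokesRegularity.NavierStokesRegularity.Theorems.UnthreadedRigidityDoorUnthreadedRigidityVirialHornDefs
import Summits.NavierStokesRegularity.NavierStokesRegularity.Theorems.UnthreadedRigidityDoorUnthreadedRigidityHornPressureDefs
import Summits.NavierStokesRegularity.NavierStokesRegularity.Theorems.ThreadingFluxHorizonTowerZonalBridge

/-!
# Route `UnthreadedRigidityDoor`, item `UnthreadedRigidity` (W2, stmt-NavierStokesRegularity-27585) — LINE g11-1 «VIRIAL HORN»,
# BRIDGE V for PLATEAU PROFILES: THE OBJECTS OF «TWO-CHANNEL RIGIDITY» (general degree `l`)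

Definition file (W2 Lean hand ns-crc-p1 g10, by lineage; `--supports stmt-NavierStokesRegularity-27585 --as helper`).

WHAT FOR.  Bridge V `VirialHorn.OrderTwoVirialIdentity` is landed for every profile WITHOUT an irrotational plateau
(`ThreadingJets.orderTwoVirialIdentity_of_dichotomy`, p714022) and is open as typed for smooth PLATEAU profiles (`K = vortAmpL l H`
vanishing on a sub-interval; residual R1 of the VIRIAL HORN card).  The files `…VirialHornTwoChannel*.lean` prove the ORDER-TWO SLICE LAW
for EVERY virial-admissible profile, plateaus included, in every degree `l ≥ 3`, for every solid harmonic `Y` meeting the algebraic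
condition `TwoChannel l Y` below (generic `Y`; it fails exactly for polyhedral-type harmonics such as `xyz`).  The argument is
harmonic-free: the slice pressure is written in the TRIANGULAR basis `F_k = Δᵏ(Y²)` (`Δ(g(|y|²)F_k) = (4sg″ + (4n_k+6)g′)F_k + g·F_{k+1}`,
`n_k = 2l − 2k`), in which the source `σ = div((u₀·∇)u₀)` of the separable shell `u₀ = a∇Y − bY·y` has exactly three components
`σ = (a²/4)F₂ + (chanG/2)F₁ + chanY·F₀`; the premise `{Y, a²|∇Y|² − y·∇p₀} = 0` on `{K ≠ 0}` then splits along the brackets `{Y,F_k}`.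

Objects (profile `H(r) = h(r²)`, variable `s = r² = |y|²`, `Y = evalE P` a solid harmonic of degree `l`):
* `sqLapP P k = lapPᵏ(P·P)` (polynomial), `sqLapF Y k = lap3ᵏ(Y²)` (function) — the cascade `F_k`; `hessSqP P = Σᵢⱼ(∂ᵢ∂ⱼP)²`
  (so `F₁ = 2|∇Y|²`, `F₂ = 4·hessSqP` for harmonic `P`); `hessMat P y` — the Hessian matrix of `P` at `y`;
* `ampA l h s = 2 s h′ + (l+1) h` (the strain amplitude `α = rH′ + (l+1)H` at `s = r²`), and the two source channels
  `chanG l h` (coefficient of `|∇Y|²`) and `chanY l h` (coefficient of `Y²`) of `σ` — the `l`-general STAGE 2 of crc-p1 g9's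
  trace formula `HornPressure.trace_shellDeriv_comp_generic` (at `l = 2` they reproduce g7's `aTwo`/`aFour` channels);
* `cascadeSrc l h k` (`k = 0,1,2`: `chanY`, `chanG/2`, `ampA²/4`; `0` beyond) and the radial coefficients `cascadeCoeff l h k`
  defined by the TRIANGULAR recursion `g_k = radCoeff (2l−2k) (cascadeSrc k + g_{k−1})` (g9's decaying radial layer `HornPressure.radCoeff`);
* `cascadePressure l h P z = Σ_{k ≤ l} g_k(|z|²)·F_k(z)` — the explicit decaying pressure of the centred shell;
* `TwoChannel l Y` — the hypothesis on `Y`: on the unit sphere, a vanishing combination `Σ_{k<l} θ_k {Y, F_k}` has `θ₁ = θ₂ = 0`.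

WHAT THIS IS NOT: no NS-regularity statement is touched; `UnthreadedRigidity` (27585), W2 and NS regularity stay OPEN; these are the
objects of the L-part of ONE bridge of a RUNG line about SPECIAL (separable) slice data.  [cite: MajdaBertozziCUP2002, §1.1 (vector identities)]
-/

-- the summit and its single sub-problem share the name (CONVENTIONS §1)
set_option linter.dupNamespace false

namespace Summit.NavierStokesRegularity.NavierStokesRegularity.Theorems.UnthreadedRigidity.VirialHorn

open MvPolynomial
open Summit.NavierStokesRegularity.NavierStokesRegularity.Theorems.UnthreadedRigidity.ProfileHorn (E3)
open Summit.NavierStokesRegularity.NavierStokesRegularity.Theorems.UnthreadedRigidity.HornPressure (radCoeff)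
open Summit.NavierStokesRegularity.NavierStokesRegularity.Theorems.PoloidalLiouville.HorizonTower (Zonal.evalE Zonal.lapP)

/-! ## The cascade `F_k = Δᵏ(Y²)` -/

/-- the `k`-th polynomial Laplacian of the square: `sqLapP P k = lapPᵏ (P·P)`. [folklore] -/
noncomputable def sqLapP (P : MvPolynomial (Fin 3) ℝ) (k : ℕ) : MvPolynomial (Fin 3) ℝ :=
  (Zonal.lapP)^[k] (P * P)

/-- the same cascade for a function `Y : E3 → ℝ`: `sqLapF Y k = lap3ᵏ (Y²)` (for `Y = evalE P` this is `evalE (sqLapP P k)`). [folklore] -/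
noncomputable def sqLapF (Y : E3 → ℝ) (k : ℕ) : E3 → ℝ :=
  (lap3)^[k] (fun y => Y y ^ 2)

/-- the squared Hessian `Σᵢⱼ (∂ᵢ∂ⱼP)²` of a polynomial. [folklore] -/
noncomputable def hessSqP (P : MvPolynomial (Fin 3) ℝ) : MvPolynomial (Fin 3) ℝ :=
  ∑ i : Fin 3, ∑ j : Fin 3, pderiv i (pderiv j P) * pderiv i (pderiv j P)


/-- the Hessian matrix of a polynomial at a point, `hessMat P y i j = (∂ⱼ∂ᵢP)(y)` (the matrix of `D(∇(evalE P))(y)` in the sense of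
`HornPressure.matCLM`; symmetric). [folklore] -/
noncomputable def hessMat (P : MvPolynomial (Fin 3) ℝ) (y : E3) : Matrix (Fin 3) (Fin 3) ℝ :=
  Matrix.of fun i j => Zonal.evalE (pderiv j (pderiv i P)) y

/-! ## The source channels of the degree-`l` separable shell, in the variable `s = r²` -/

/-- strain amplitude in the `s`-picture: `ampA l h s = 2 s h′(s) + (l+1) h(s)` (`= strainAmpL l H r` at `s = r²`, `H(r) = h(r²)`). [folklore] -/
noncomputable def ampA (l : ℕ) (h : ℝ → ℝ) (s : ℝ) : ℝ :=
  2 * s * deriv h s + ((l : ℝ) + 1) * h s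

/-- the `|∇Y|²`-channel of the pressure source `σ = div((u₀·∇)u₀)` of the shell `u₀ = A∇Y − B Y y`
(`A = ampA`, `A′ = (l+3)h′ + 2sh″`, `B = 2l h′`, `B′ = 2l h″`): `chanG = 4(l−1)AA′ − 4sA′B − 2(l−1)AB`. [folklore] -/
noncomputable def chanG (l : ℕ) (h : ℝ → ℝ) (s : ℝ) : ℝ :=
  4 * ((l : ℝ) - 1) * (2 * s * deriv h s + ((l : ℝ) + 1) * h s) * (((l : ℝ) + 3) * deriv h s + 2 * s * deriv (deriv h) s)
    - 4 * s * (((l : ℝ) + 3) * deriv h s + 2 * s * deriv (deriv h) s) * (2 * (l : ℝ) * deriv h s)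
    - 2 * ((l : ℝ) - 1) * (2 * s * deriv h s + ((l : ℝ) + 1) * h s) * (2 * (l : ℝ) * deriv h s)

/-- the `Y²`-channel of the pressure source (same abbreviations):
`chanY = 4l²A′² + 4s²B′² + (l²+2l+3)B² − 8lsA′B′ − 4lA′B − 4l(l−1)AB′ + 4(l+1)sBB′`. [folklore] -/
noncomputable def chanY (l : ℕ) (h : ℝ → ℝ) (s : ℝ) : ℝ :=
  4 * (l : ℝ) ^ 2 * (((l : ℝ) + 3) * deriv h s + 2 * s * deriv (deriv h) s) ^ 2
    + 4 * s ^ 2 * (2 * (l : ℝ) * deriv (deriv h) s) ^ 2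
    + ((l : ℝ) ^ 2 + 2 * l + 3) * (2 * (l : ℝ) * deriv h s) ^ 2
    - 8 * (l : ℝ) * s * (((l : ℝ) + 3) * deriv h s + 2 * s * deriv (deriv h) s) * (2 * (l : ℝ) * deriv (deriv h) s)
    - 4 * (l : ℝ) * (((l : ℝ) + 3) * deriv h s + 2 * s * deriv (deriv h) s) * (2 * (l : ℝ) * deriv h s)
    - 4 * (l : ℝ) * ((l : ℝ) - 1) * (2 * s * deriv h s + ((l : ℝ) + 1) * h s) * (2 * (l : ℝ) * deriv (deriv h) s)
    + 4 * ((l : ℝ) + 1) * s * (2 * (l : ℝ) * deriv h s) * (2 * (l : ℝ) * deriv (deriv h) s)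

/-! ## The triangular radial cascade and the explicit pressure -/

/-- the source of level `k` in the basis `F_k = Δᵏ(Y²)`: `σ = chanY·F₀ + (chanG/2)·F₁ + (ampA²/4)·F₂`
(`F₁ = 2|∇Y|²`, `F₂ = 4|Hess Y|²`); no source beyond level `2`. [folklore] -/
noncomputable def cascadeSrc (l : ℕ) (h : ℝ → ℝ) : ℕ → ℝ → ℝ
  | 0 => chanY l h
  | 1 => fun s => chanG l h s / 2
  | 2 => fun s => ampA l h s ^ 2 / 4
  | _ => fun _ => 0

/-- the radial coefficients `g_k` of the explicit pressure, by the triangular recursion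
`g_0 = radCoeff (2l) (cascadeSrc 0)`, `g_{k+1} = radCoeff (2l − 2(k+1)) (cascadeSrc (k+1) + g_k)`
(so that `4s g_k″ + (4(2l−2k)+6) g_k′ = −(cascadeSrc k + g_{k−1})`). [folklore] -/
noncomputable def cascadeCoeff (l : ℕ) (h : ℝ → ℝ) : ℕ → ℝ → ℝ
  | 0 => radCoeff (2 * l) (cascadeSrc l h 0)
  | k + 1 => radCoeff (2 * l - 2 * (k + 1)) (fun s => cascadeSrc l h (k + 1) s + cascadeCoeff l h k s)

/-- THE EXPLICIT PRESSURE of the centred degree-`l` shell `z ↦ curl curl (h(|z|²) Y(z) z)`, `Y = evalE P`: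
`p*(z) = Σ_{k ≤ l} g_k(|z|²) · (Δᵏ Y²)(z)`.  It is smooth, solves `Δp* = −σ`, tends to `0` at infinity, and therefore IS the decaying
slice pressure `p₀(x₀ + ·)`. [folklore] -/
noncomputable def cascadePressure (l : ℕ) (h : ℝ → ℝ) (P : MvPolynomial (Fin 3) ℝ) (z : E3) : ℝ :=
  ∑ k ∈ Finset.range (l + 1), cascadeCoeff l h k (‖z‖ ^ 2) * Zonal.evalE (sqLapP P k) z

/-! ## The hypothesis on the harmonic -/

/-- «TWO CHANNELS»: the brackets `{Y, Δ(Y²)}` and `{Y, Δ²(Y²)}` are honest channels of `Y` — on the unit sphere no linear combination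
`Σ_{k<l} θ_k {Y, Δᵏ(Y²)}` vanishes identically unless `θ₁ = θ₂ = 0` (the `k = 0` bracket `{Y,Y²}` is identically zero and carries no
condition).  Holds for generic solid harmonics of every degree `l ≥ 3`; fails for `l ≤ 2` (no `k = 2` channel) and for the polyhedral
harmonics `xyz` (`|Hess Y|²` radial) and `x⁴+y⁴+z⁴ − (3/5)|y|⁴`. [folklore] -/
def TwoChannel (l : ℕ) (Y : E3 → ℝ) : Prop :=
  ∀ θ : ℕ → ℝ, (∀ y : E3, ‖y‖ = 1 → ∑ k ∈ Finset.range l, θ k * pbr Y (sqLapF Y k) y = 0) → θ 1 = 0 ∧ θ 2 = 0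


/-! ## The Euler operators of the gluing step (appended) -/

/-- the first-order EULER OPERATOR `(rD + m)f = r f′ + m f` on profiles; it annihilates `r^{−m}`. [folklore] -/
noncomputable def eulerOp (m : ℝ) (f : ℝ → ℝ) : ℝ → ℝ :=
  fun r => r * deriv f r + m * f r

/-- the fourth-order Euler operator `L₄ = (rD)(rD + l)(rD + l + 1)(rD + 2l + 1)` whose kernel on `(0,∞)` is
`span{1, r^{−l}, r^{−l−1}, r^{−2l−1}}` — it contains both local families of a profile satisfying the two channel equations
(`span{r^{−l}, r^{−l−1}}` where `K ≠ 0`, `span{1, r^{−2l−1}}` where `K ≡ 0`). [folklore] -/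
noncomputable def eulerL4 (l : ℕ) (f : ℝ → ℝ) : ℝ → ℝ :=
  eulerOp 0 (eulerOp (l : ℝ) (eulerOp ((l : ℝ) + 1) (eulerOp (2 * (l : ℝ) + 1) f)))


/-! ## Products of Euler operators and finite power sums (appended; the PLATEAU PROPAGATION step) -/

/-- a product of first-order Euler operators: `eulerL [c₁, …, cₙ] f = (rD + c₁)((rD + c₂)(⋯((rD + cₙ) f)))`.  On `(0,∞)` the factors
commute, `(rD + c)(r^d w) = r^d (rD + c + d) w`, and `eulerL` of a list containing `−z` kills `r^z`. [folklore] -/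
noncomputable def eulerL (cs : List ℝ) (f : ℝ → ℝ) : ℝ → ℝ :=
  cs.foldr eulerOp f

/-- a finite POWER SUM `Σᵢ cᵢ r^{zᵢ}` with integer exponents — the shape, on an irrotational plateau `H = A + B r^{−2l−1}`, of every
source channel, every cascade coefficient and hence of the premise `α²𝒜 − {Y, y·∇p₀}` along each ray. [folklore] -/
noncomputable def powSum (L : List (ℝ × ℤ)) (r : ℝ) : ℝ :=
  (L.map fun p => p.1 * r ^ p.2).sum

/-- the K-FREE ORDER-TWO PREMISE ALONG THE RAY through `ŷ`: `Θ_ŷ(r) = α(r)²·𝒜(rŷ) − {Y, z·∇p₀(x₀+z)}(rŷ)` (the bracket of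
`ThreadingJets.OrderTwoLawSlice` / `VirialLemmaSlice`); it vanishes where `K(r) ≠ 0`, and PLATEAU PROPAGATION shows it vanishes
everywhere. [folklore] -/
noncomputable def premiseRay (l : ℕ) (H : ℝ → ℝ) (Y : E3 → ℝ) (p₀ : E3 → ℝ) (x₀ ŷ : E3) (r : ℝ) : ℝ :=
  strainAmpL l H r ^ 2 * angForm Y (r • ŷ) - pbr Y (fun z : E3 => inner ℝ z (gradient p₀ (x₀ + z))) (r • ŷ)

/-- the CLOSED FORM of the ray premise on `(0,∞)` in the cascade basis (`‖ŷ‖ = 1`, `Y = evalE P`, profile `h`):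
`(𝒜₁(ŷ)/2)·r^{d₁}·ampA(r²)² − Σ_{k<l} 𝒜_k(ŷ)·r^{d_k}·(rD + 2l − 2k)(g_k(r²))`, `𝒜_k = {Y, Δᵏ(Y²)}`, `d_k = 1 + ((l−1) + (2l−2k−1))`. [folklore] -/
noncomputable def premiseRayExp (l : ℕ) (h : ℝ → ℝ) (P : MvPolynomial (Fin 3) ℝ) (ŷ : E3) (r : ℝ) : ℝ :=
  (1 / 2 * pbr (Zonal.evalE P) (sqLapF (Zonal.evalE P) 1) ŷ) * (r ^ (1 + (l - 1 + (2 * l - 2 * 1 - 1))) * ampA l h (r ^ 2) ^ 2)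
    - ∑ k ∈ Finset.range l, pbr (Zonal.evalE P) (sqLapF (Zonal.evalE P) k) ŷ *
        (r ^ (1 + (l - 1 + (2 * l - 2 * k - 1))) * eulerOp ((2 * l - 2 * k : ℕ) : ℝ) (fun x : ℝ => cascadeCoeff l h k (x ^ 2)) r)

end Summit.NavierStokesRegularity.NavierStokesRegularity.Theorems.UnthreadedRigidity.VirialHorn
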